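import Literature.NumberTheory.GaloisRepresentations.RestrictedRamification
import Literature.NumberTheory.GaloisRepresentations.ArtinRestriction
import HarnessLib

/-!
# Base change of the restricted-ramification group along a finite extension inside `K_S`:
# `G_{L,S_L} ≃ₜ* Gal(K_S/L) ≤ G_{K,S}` (Neukirch–Schmidt–Wingberg VIII §3)

Topic `NumberTheory/GaloisRepresentations`; namespace `Literature.NumberTheory.GaloisRepresentations`.
THEOREMS ONLY (no definition, no named fact, no `sorry`, no instance, no notation; D-0026).

SETTING.  `K ⊆ L` number fields (`[Algebra K L]`, `L/K` algebraic), `S` a set of finite places of `K`,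
`S_L = {w : HeightOneSpectrum (𝓞 L) | w.under (𝓞 K) ∈ S}` the set of places of `L` above `S`, `res = absGaloisRestrict K L : Γ_L → Γ_K` the
(injective, continuous) restriction of absolute Galois groups, `N_S(K) ≤ Γ_K` and `N_{S_L}(L) ≤ Γ_L` the
ramification subgroups (closed normal closures of the inertia groups outside `S`, resp. `S_L`), so that
`G_{K,S} = Γ_K ⧸ N_S(K)`, `G_{L,S_L} = Γ_L ⧸ N_{S_L}(L)`.  NSW (8.3.x) / Harari §15.6 use tacitly: if
`L ⊆ K_S` then `L_{S_L} = K_S`, i.e. `G_{L,S_L} = Gal(K_S/L)` is the open subgroup of `G_{K,S}` cut out by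
`L`.  This file proves it in the tree's group-theoretic currency:

* §1 the places of `L` above `S`, `{w | w.under (𝓞 K) ∈ S}`, finite for finite `S` (`setOf_under_mem_finite'`);
* §2 **`res(N_{S_L}(L)) ≤ N_S(K)`** (`ramificationSubgroup_le_comap_absGaloisRestrict`: an inertia group of
  `L̄/L` at a prime outside `S_L` restricts into the inertia group of `K̄/K` at the prime below, tree
  `absGaloisRestrict_mem_inertia_comap`), and, when `L ⊆ K_S` (hypothesis
  `N_S(K) ≤ range res`, i.e. `N_S(K)` fixes the copy of `L` in `K̄`), **`res⁻¹(N_S(K)) = N_{S_L}(L)`**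
  (`comap_absGaloisRestrict_ramificationSubgroup`: every inertia group `I_𝔓 ≤ N_S(K) ≤ res Γ_L` IS the
  restriction of the inertia group of `L̄/L` at the prime `𝔓` read in `\bar ℤ_L`, tree
  `comap_inertia_comap_absIntegersMap`);
* §3 the open subgroup `U = (res Γ_L) N_S / N_S ≤ G_{K,S}` (Greenberg's `galoisGroupAbove S (res Γ_L)`;
  `isOpen_map_toUnramifiedQuot_range_absGaloisRestrict`) and the EXISTENCE of a topological group
  isomorphism **`G_{L,S_L} ≃ₜ* ↥U` compatible with the projections** (`σ N_{S_L} ↦ (res σ) N_S`;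
  `exists_continuousMulEquiv_galoisGroupUnramifiedOutside`: a continuous bijective homomorphism from a
  compact group onto a Hausdorff one).  THEOREMS ONLY.

USE (sequel `GaloisCohomology/RestrictedRamificationFiniteCohomologyBaseChange`): Harari Cor. 17.17 /
NSW (8.3.20) (`finite_restrictedCohomology`) descends from the totally complex cyclotomic layer
`L = K(ζ_q) ⊆ K_S` to an ARBITRARY number field `K` (Shapiro + dimension shifting along `U ≤ G_{K,S}`),
whence Greenberg 2006 Prop. 3.2 for every number field.

## References
* J. Neukirch, A. Schmidt, K. Wingberg, *Cohomology of Number Fields*, 2nd ed. (2008), VIII §3 (the group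
  `G_S`, `k_S`; `G_S(K) ≤ G_S(k)` for `k ⊆ K ⊆ k_S`). [NeukirchSchmidtWingberg2008]
* D. Harari, *Galois Cohomology and Class Field Theory* (2020), Def. 15.36, §17.2. [Harari2020]
* J. Neukirch, *Algebraic Number Theory* (1999), Ch. I §9 (9.4)–(9.6) (inertia groups in towers).
  [NeukirchANT1999]
-/

noncomputable section

open scoped NumberField Pointwise
open Field IsDedekindDomain NumberField Topology

namespace Literature.NumberTheory.GaloisRepresentations

variable {K : Type} [Field K] (L : Type) [Field L] [Algebra K L]

/-! ## §1. The places of `L` above `S`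

Throughout, the set of places of `L` above `S` is written `{w | w.under (𝓞 K) ∈ S}` (Mathlib
`HeightOneSpectrum.under`; no definition is introduced). -/

omit [Algebra K L] in
/-- The ideal-level reading of `w.under`: `(w ∩ 𝓞 K) = v` as ideals iff `w.under (𝓞 K) = v`.
[cite: NeukirchANT1999, Ch. I §9] -/
theorem under_eq_iff_asIdeal [Algebra K L] {w : HeightOneSpectrum (𝓞 L)} {v : HeightOneSpectrum (𝓞 K)} :
    w.under (𝓞 K) = v ↔ w.asIdeal.under (𝓞 K) = v.asIdeal := by
  constructor
  · rintro rfl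
    rfl
  · intro h
    exact HeightOneSpectrum.ext h

variable [NumberField K] [NumberField L] in
/-- **Finitely many places of `L` lie above a finite set of places of `K`** (each `v` has finitely many
primes of `𝓞 L` above it, Mathlib `primesOver_finite`). [cite: NeukirchANT1999, Ch. I §8] -/
theorem setOf_under_mem_finite' {S : Set (HeightOneSpectrum (𝓞 K))} (hS : S.Finite) :
    {w : HeightOneSpectrum (𝓞 L) | w.under (𝓞 K) ∈ S}.Finite := by
  have h : {w : HeightOneSpectrum (𝓞 L) | w.under (𝓞 K) ∈ S} ⊆
      ⋃ v ∈ S, {w : HeightOneSpectrum (𝓞 L) | w.asIdeal ∈ v.asIdeal.primesOver (𝓞 L)} := by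
    intro w hw
    simp only [Set.mem_iUnion, Set.mem_setOf_eq]
    exact ⟨w.under (𝓞 K), hw, w.isPrime, ⟨rfl⟩⟩
  refine (hS.biUnion fun v _ => ?_).subset h
  have hf := IsDedekindDomain.primesOver_finite v.asIdeal (𝓞 L)
  refine (hf.preimage ?_ : {w : HeightOneSpectrum (𝓞 L) | w.asIdeal ∈ v.asIdeal.primesOver (𝓞 L)}.Finite)
  exact fun w _ w' _ h => HeightOneSpectrum.ext h

/-- A place `w` of `L` outside `S_L` lies above a place of `K` outside `S` (namely `w ∩ 𝓞 K`).
[cite: NeukirchANT1999, Ch. I §9] -/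
theorem under_not_mem_of_not_mem_setOf_under_mem {S : Set (HeightOneSpectrum (𝓞 K))}
    {w : HeightOneSpectrum (𝓞 L)} (hw : w ∉ {w : HeightOneSpectrum (𝓞 L) | w.under (𝓞 K) ∈ S}) : w.under (𝓞 K) ∉ S :=
  hw

/-- The integers killing the coefficients transfer: if every place of `K` dividing `n` lies in `S`,
every place of `L` dividing `n` lies in `S_L`. [cite: NeukirchSchmidtWingberg2008, VIII §3] -/
theorem under_mem_of_natCast_mem {S : Set (HeightOneSpectrum (𝓞 K))} {n : ℕ}
    (hS : ∀ v : HeightOneSpectrum (𝓞 K), ((n : ℕ) : 𝓞 K) ∈ v.asIdeal → v ∈ S)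
    (w : HeightOneSpectrum (𝓞 L)) (hw : ((n : ℕ) : 𝓞 L) ∈ w.asIdeal) : w ∈ {w : HeightOneSpectrum (𝓞 L) | w.under (𝓞 K) ∈ S} := by
  refine hS _ ?_
  rw [HeightOneSpectrum.under_asIdeal, Ideal.mem_comap, map_natCast]
  exact hw

/-! ## §2. Ramification subgroups along `res : Γ_L → Γ_K` -/

section Ramification

variable (S : Set (HeightOneSpectrum (𝓞 K)))

/-- **An inertia group of `L̄/L` outside `S_L` restricts into `N_S(K)`**: for a prime `𝔔` of `\bar ℤ_L`
above a place `w ∉ S_L` and `σ ∈ I_𝔔 ≤ Γ_L`, `res σ` lies in the inertia group of the prime `ι⁻¹𝔔` of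
`\bar ℤ_K`, which lies above `w ∩ 𝓞 K ∉ S`. [cite: NeukirchANT1999, Ch. I §9 Prop. (9.4)] -/
theorem absGaloisRestrict_mem_ramificationSubgroup_of_mem_inertia {w : HeightOneSpectrum (𝓞 L)}
    (hw : w ∉ {w : HeightOneSpectrum (𝓞 L) | w.under (𝓞 K) ∈ S}) {𝔔 : Ideal (absIntegers (𝓞 L) L)} (h𝔔 : 𝔔 ∈ w.primesAbove)
    {σ : absoluteGaloisGroup L} (hσ : σ ∈ 𝔔.inertia (absoluteGaloisGroup L)) :
    absGaloisRestrict K L σ ∈ ramificationSubgroup K S := by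
  have hv : w.asIdeal.under (𝓞 K) = (w.under (𝓞 K)).asIdeal := (HeightOneSpectrum.under_asIdeal _ _).symm
  have hw' : w.under (𝓞 K) ∉ S := hw
  exact inertia_le_ramificationSubgroup (K := K) hw' (comap_absIntegersMap_mem_primesAbove hv h𝔔)
    (absGaloisRestrict_mem_inertia_comap K L hσ)

/-- **`N_{S_L}(L) ≤ res⁻¹(N_S(K))`**, i.e. `res (N_{S_L}(L)) ≤ N_S(K)`: the preimage of the closed normal
subgroup `N_S(K)` under the continuous homomorphism `res` is a closed normal subgroup of `Γ_L` containing
every inertia group outside `S_L`. [cite: NeukirchSchmidtWingberg2008, VIII §3] [cite: NeukirchANT1999, Ch. I §9 Prop. (9.4)] -/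
theorem ramificationSubgroup_le_comap_absGaloisRestrict :
    ramificationSubgroup L ({w : HeightOneSpectrum (𝓞 L) | w.under (𝓞 K) ∈ S}) ≤
      (ramificationSubgroup K S).comap (absGaloisRestrict K L : absoluteGaloisGroup L →* absoluteGaloisGroup K) := by
  haveI : ((ramificationSubgroup K S).comap
      (absGaloisRestrict K L : absoluteGaloisGroup L →* absoluteGaloisGroup K)).Normal :=
    Subgroup.normal_comap _
  refine Subgroup.topologicalClosure_minimal _ ?_ ?_
  · refine Subgroup.normalClosure_le_normal fun σ hσ => ?_
    obtain ⟨w, hw, 𝔔, h𝔔, hσ⟩ := mem_inertiaOutside_iff.mp hσ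
    exact absGaloisRestrict_mem_ramificationSubgroup_of_mem_inertia L S hw h𝔔 hσ
  · exact (ramificationSubgroup_isClosed K S).preimage (absGaloisRestrict K L).continuous_toFun

/-- Pointwise form: `σ ∈ N_{S_L}(L) ⟹ res σ ∈ N_S(K)`. [cite: NeukirchSchmidtWingberg2008, VIII §3] -/
theorem absGaloisRestrict_mem_ramificationSubgroup {σ : absoluteGaloisGroup L}
    (hσ : σ ∈ ramificationSubgroup L ({w : HeightOneSpectrum (𝓞 L) | w.under (𝓞 K) ∈ S})) :
    absGaloisRestrict K L σ ∈ ramificationSubgroup K S :=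
  ramificationSubgroup_le_comap_absGaloisRestrict L S hσ

variable [Algebra.IsAlgebraic K L]

/-- The prime `ι 𝔓` of `\bar ℤ_L` corresponding to a prime `𝔓` of `\bar ℤ_K` under `\bar ℤ_K ≅ \bar ℤ_L`
contracts back to `𝔓`. [cite: NeukirchANT1999, Ch. I §9] -/
theorem comap_absIntegersMap_comap_symm (𝔓 : Ideal (absIntegers (𝓞 K) K)) :
    (𝔓.comap ((absIntegersEquiv K L).symm : absIntegers (𝓞 L) L →+* absIntegers (𝓞 K) K)).comap
        (absIntegersMap K L) = 𝔓 := by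
  rw [Ideal.comap_comap]
  have h : ((absIntegersEquiv K L).symm : absIntegers (𝓞 L) L →+* absIntegers (𝓞 K) K).comp
      (absIntegersMap K L) = RingHom.id _ :=
    RingHom.ext fun x => (absIntegersEquiv K L).symm_apply_apply x
  rw [h, Ideal.comap_id]

/-- **Inside `K_S` the inertia groups of `K` outside `S` are restrictions of inertia groups of `L` outside
`S_L`**: if `N_S(K) ≤ res Γ_L` (`L ⊆ K_S`), every `σ` in an inertia group `I_𝔓 ≤ Γ_K` above `v ∉ S` is
`res τ` for some `τ` in the inertia group of `L̄/L` at the prime `ι 𝔓`, which lies above a place of `L`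
outside `S_L`. [cite: NeukirchANT1999, Ch. I §9 Prop. (9.4)–(9.6)] [cite: NeukirchSchmidtWingberg2008, VIII §3] -/
theorem exists_mem_inertia_absGaloisRestrict_eq
    (hKS : ramificationSubgroup K S ≤ (absGaloisRestrict K L).range)
    {v : HeightOneSpectrum (𝓞 K)} (hv : v ∉ S) {𝔓 : Ideal (absIntegers (𝓞 K) K)} (h𝔓 : 𝔓 ∈ v.primesAbove)
    {σ : absoluteGaloisGroup K} (hσ : σ ∈ 𝔓.inertia (absoluteGaloisGroup K)) :
    ∃ τ : absoluteGaloisGroup L, τ ∈ ramificationSubgroup L ({w : HeightOneSpectrum (𝓞 L) | w.under (𝓞 K) ∈ S}) ∧ absGaloisRestrict K L τ = σ := by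
  obtain ⟨τ, hτ⟩ := hKS (inertia_le_ramificationSubgroup hv h𝔓 hσ)
  refine ⟨τ, ?_⟩
  -- the prime of `\bar ℤ_L` corresponding to `𝔓`
  set 𝔔 : Ideal (absIntegers (𝓞 L) L) :=
    𝔓.comap ((absIntegersEquiv K L).symm : absIntegers (𝓞 L) L →+* absIntegers (𝓞 K) K) with h𝔔def
  haveI : Ideal.IsPrime 𝔓 := h𝔓.1
  haveI h𝔔p : 𝔔.IsPrime := Ideal.comap_isPrime _ 𝔓
  have h𝔔𝔓 : 𝔔.comap (absIntegersMap K L) = 𝔓 := comap_absIntegersMap_comap_symm L 𝔓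
  have h𝔔v : 𝔔.comap (absIntegersMap K L) ∈ v.primesAbove := by rw [h𝔔𝔓]; exact h𝔓
  obtain ⟨w, hwv, h𝔔w, -⟩ := exists_heightOneSpectrum_of_comap_absIntegersMap_mem_primesAbove h𝔔v
  -- `w ∉ S_L` since `w ∩ 𝓞 K = v ∉ S`
  have hw : w ∉ {w : HeightOneSpectrum (𝓞 L) | w.under (𝓞 K) ∈ S} := by
    intro hw
    rw [Set.mem_setOf_eq, (under_eq_iff_asIdeal L).mpr hwv] at hw
    exact hv hw
  -- `τ ∈ res⁻¹(I_𝔓) = I_𝔔`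
  have hτ' : absGaloisRestrict K L τ = σ := hτ
  have hτ𝔔 : τ ∈ 𝔔.inertia (absoluteGaloisGroup L) := by
    rw [← comap_inertia_comap_absIntegersMap K L 𝔔, Subgroup.mem_comap, h𝔔𝔓]
    change absGaloisRestrict K L τ ∈ _
    rw [hτ']
    exact hσ
  refine ⟨?_, hτ'⟩
  exact inertia_le_ramificationSubgroup hw h𝔔w hτ𝔔

variable [NumberField L] in
/-- **`N_S(K) ≤ res (N_{S_L}(L))` inside `K_S`.** If `N_S(K) ≤ res Γ_L` then every element of `N_S(K)` is
the restriction of an element of `N_{S_L}(L)`: the generating inertia groups are (previous lemma), the set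
of them is conjugation-stable, and `res (N_{S_L}(L))` is a closed subgroup (continuous image of a compact
group in a Hausdorff group). [cite: NeukirchSchmidtWingberg2008, VIII §3] -/
theorem ramificationSubgroup_le_map_absGaloisRestrict
    (hKS : ramificationSubgroup K S ≤ (absGaloisRestrict K L).range) :
    ramificationSubgroup K S ≤
      (ramificationSubgroup L ({w : HeightOneSpectrum (𝓞 L) | w.under (𝓞 K) ∈ S})).map
        (absGaloisRestrict K L : absoluteGaloisGroup L →* absoluteGaloisGroup K) := by
  set T := (ramificationSubgroup L ({w : HeightOneSpectrum (𝓞 L) | w.under (𝓞 K) ∈ S})).map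
    (absGaloisRestrict K L : absoluteGaloisGroup L →* absoluteGaloisGroup K) with hT
  -- `T` is closed: the continuous image of the compact `N_{S_L}(L)`
  have hTc : IsClosed (T : Set (absoluteGaloisGroup K)) := by
    have hcpt : IsCompact ((ramificationSubgroup L ({w : HeightOneSpectrum (𝓞 L) | w.under (𝓞 K) ∈ S}) : Subgroup (absoluteGaloisGroup L)) :
        Set (absoluteGaloisGroup L)) :=
      (ramificationSubgroup_isClosed L ({w : HeightOneSpectrum (𝓞 L) | w.under (𝓞 K) ∈ S})).isCompact
    have himg := hcpt.image (absGaloisRestrict K L).continuous_toFun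
    rw [hT, Subgroup.coe_map]
    exact himg.isClosed
  -- the generators lie in `T`
  have hgen : inertiaOutside K S ⊆ (T : Set (absoluteGaloisGroup K)) := by
    intro σ hσ
    obtain ⟨v, hv, 𝔓, h𝔓, hσ⟩ := mem_inertiaOutside_iff.mp hσ
    obtain ⟨τ, hτN, hτ⟩ := exists_mem_inertia_absGaloisRestrict_eq L S hKS hv h𝔓 hσ
    exact ⟨τ, hτN, hτ⟩
  -- hence the conjugates of the generators, the normal closure and its closure
  have hconj : Group.conjugatesOfSet (inertiaOutside K S) ⊆ (T : Set (absoluteGaloisGroup K)) := by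
    intro x hx
    obtain ⟨a, ha, hc⟩ := Group.mem_conjugatesOfSet_iff.mp hx
    obtain ⟨c, rfl⟩ := isConj_iff.mp hc
    exact hgen (conj_mem_inertiaOutside ha c)
  have hnc : Subgroup.normalClosure (inertiaOutside K S) ≤ T := by
    unfold Subgroup.normalClosure
    exact (Subgroup.closure_le _).mpr hconj
  exact Subgroup.topologicalClosure_minimal _ hnc hTc

variable [NumberField L] in
/-- **`res⁻¹(N_S(K)) = N_{S_L}(L)` inside `K_S`** (`res` injective for `L/K` algebraic).
[cite: NeukirchSchmidtWingberg2008, VIII §3] -/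
theorem comap_absGaloisRestrict_ramificationSubgroup
    (hKS : ramificationSubgroup K S ≤ (absGaloisRestrict K L).range) :
    (ramificationSubgroup K S).comap
        (absGaloisRestrict K L : absoluteGaloisGroup L →* absoluteGaloisGroup K) =
      ramificationSubgroup L ({w : HeightOneSpectrum (𝓞 L) | w.under (𝓞 K) ∈ S}) := by
  refine le_antisymm ?_ (ramificationSubgroup_le_comap_absGaloisRestrict L S)
  intro x hx
  obtain ⟨y, hy, hyx⟩ := ramificationSubgroup_le_map_absGaloisRestrict L S hKS (Subgroup.mem_comap.mp hx)
  have : y = x := absGaloisRestrict_injective K L hyx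
  exact this ▸ hy

variable [NumberField L] in
/-- **`res (N_{S_L}(L)) = N_S(K)` inside `K_S`.** [cite: NeukirchSchmidtWingberg2008, VIII §3] -/
theorem map_absGaloisRestrict_ramificationSubgroup
    (hKS : ramificationSubgroup K S ≤ (absGaloisRestrict K L).range) :
    (ramificationSubgroup L ({w : HeightOneSpectrum (𝓞 L) | w.under (𝓞 K) ∈ S})).map
        (absGaloisRestrict K L : absoluteGaloisGroup L →* absoluteGaloisGroup K) =
      ramificationSubgroup K S := by
  refine le_antisymm ?_ (ramificationSubgroup_le_map_absGaloisRestrict L S hKS)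
  rintro _ ⟨τ, hτ, rfl⟩
  exact absGaloisRestrict_mem_ramificationSubgroup L S hτ

end Ramification

/-! ## §3. The isomorphism `G_{L,S_L} ≃ₜ* Gal(K_S/L) ≤ G_{K,S}` -/

section Hom

variable (S : Set (HeightOneSpectrum (𝓞 K)))

/-- The image `res Γ_L ≤ Γ_K` is OPEN for `L/K` finite (it is the fixing subgroup of the copy `e(L) ⊆ K̄`
of `L`, tree `exists_mem_range_absGaloisRestrict_iff`; Mathlib `IntermediateField.fixingSubgroup_isOpen`).
[cite: NeukirchANT1999, Ch. IV §1 (infinite Galois theory)] -/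
theorem isOpen_range_absGaloisRestrict' [FiniteDimensional K L] :
    IsOpen (((absGaloisRestrict K L).range : Subgroup (absoluteGaloisGroup K)) : Set (absoluteGaloisGroup K)) := by
  obtain ⟨e, he⟩ := exists_mem_range_absGaloisRestrict_iff K L
  have hK' : ((absGaloisRestrict K L).range : Subgroup (absoluteGaloisGroup K)) =
      (e.fieldRange.fixingSubgroup : Subgroup (absoluteGaloisGroup K)) := by
    ext g
    refine (he g).trans (Iff.trans ?_ (mem_fixingSubgroup_iff_forall_smul e.fieldRange g).symm)
    constructor
    · rintro h ⟨x, ⟨k, rfl⟩⟩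
      exact h k
    · intro h k
      exact h ⟨e k, ⟨k, rfl⟩⟩
  haveI : FiniteDimensional K e.fieldRange :=
    LinearEquiv.finiteDimensional e.equivFieldRange.toLinearEquiv
  rw [hK']
  exact e.fieldRange.fixingSubgroup_isOpen

/-- **`Gal(K_S/L) = (res Γ_L) N_S / N_S ≤ G_{K,S}` is open** for `L/K` finite (`res Γ_L` is open in `Γ_K` and
`Γ_K ↠ G_{K,S}` is an open map); it is Greenberg's `galoisGroupAbove S (res Γ_L)`.
[cite: NeukirchSchmidtWingberg2008, VIII §3] -/
theorem isOpen_map_toUnramifiedQuot_range_absGaloisRestrict [FiniteDimensional K L] :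
    IsOpen ((((absGaloisRestrict K L).range).map (toUnramifiedQuot K S) :
      Subgroup (GaloisGroupUnramifiedOutside K S)) : Set (GaloisGroupUnramifiedOutside K S)) := by
  rw [Subgroup.coe_map]
  exact isOpenMap_toUnramifiedQuot K S _ (isOpen_range_absGaloisRestrict' L)

variable [NumberField L] [Algebra.IsAlgebraic K L] in
/-- **The topological group isomorphism `G_{L,S_L} ≃ₜ* Gal(K_S/L)`** onto the open subgroup
`(res Γ_L) N_S / N_S ≤ G_{K,S}`, for `L ⊆ K_S` (`N_S(K) ≤ res Γ_L`), COMPATIBLE WITH THE PROJECTIONS: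
`e (σ N_{S_L}(L)) = (res σ) N_S(K)`.  Construction: `σ N_{S_L} ↦ (res σ) N_S` is a well-defined
(`ramificationSubgroup_le_comap_absGaloisRestrict`) continuous injective (`comap_absGaloisRestrict_ramificationSubgroup`)
homomorphism of the compact group `G_{L,S_L}` onto the Hausdorff group `(res Γ_L) N_S / N_S`, hence a
homeomorphism onto it. [cite: NeukirchSchmidtWingberg2008, VIII §3] [cite: Harari2020, Def. 15.36] -/
theorem exists_continuousMulEquiv_galoisGroupUnramifiedOutside
    (hKS : ramificationSubgroup K S ≤ (absGaloisRestrict K L).range) :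
    ∃ e : GaloisGroupUnramifiedOutside L {w : HeightOneSpectrum (𝓞 L) | w.under (𝓞 K) ∈ S} ≃ₜ*
        ↥(((absGaloisRestrict K L).range).map (toUnramifiedQuot K S) :
          Subgroup (GaloisGroupUnramifiedOutside K S)),
      ∀ σ : absoluteGaloisGroup L,
        ((e (σ : GaloisGroupUnramifiedOutside L {w : HeightOneSpectrum (𝓞 L) | w.under (𝓞 K) ∈ S}) :
            ↥(((absGaloisRestrict K L).range).map (toUnramifiedQuot K S) :
              Subgroup (GaloisGroupUnramifiedOutside K S))) : GaloisGroupUnramifiedOutside K S) =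
          toUnramifiedQuot K S (absGaloisRestrict K L σ) := by
  -- the homomorphism `σ N_{S_L} ↦ (res σ) N_S`
  let φ : absoluteGaloisGroup L →* GaloisGroupUnramifiedOutside K S :=
    (toUnramifiedQuot K S).comp (absGaloisRestrict K L : absoluteGaloisGroup L →* absoluteGaloisGroup K)
  have hφ : ramificationSubgroup L {w : HeightOneSpectrum (𝓞 L) | w.under (𝓞 K) ∈ S} ≤ φ.ker := fun σ hσ => by
    rw [MonoidHom.mem_ker, MonoidHom.comp_apply, QuotientGroup.mk'_apply, QuotientGroup.eq_one_iff]
    exact absGaloisRestrict_mem_ramificationSubgroup L S hσ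
  let f₀ : GaloisGroupUnramifiedOutside L {w : HeightOneSpectrum (𝓞 L) | w.under (𝓞 K) ∈ S} →* GaloisGroupUnramifiedOutside K S :=
    QuotientGroup.lift _ φ hφ
  have hf₀ : ∀ σ : absoluteGaloisGroup L,
      f₀ (σ : GaloisGroupUnramifiedOutside L {w : HeightOneSpectrum (𝓞 L) | w.under (𝓞 K) ∈ S}) = toUnramifiedQuot K S (absGaloisRestrict K L σ) :=
    fun _ => rfl
  -- continuity
  have hcont₀ : Continuous f₀ := by
    refine (QuotientGroup.isQuotientMap_mk _).continuous_iff.mpr ?_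
    change Continuous fun σ : absoluteGaloisGroup L => toUnramifiedQuot K S (absGaloisRestrict K L σ)
    exact (continuous_toUnramifiedQuot K S).comp (absGaloisRestrict K L).continuous_toFun
  -- injectivity
  have hinj₀ : Function.Injective f₀ := by
    rw [injective_iff_map_eq_one]
    intro x hx
    induction x using QuotientGroup.induction_on with
    | H σ =>
      have hx' : absGaloisRestrict K L σ ∈ ramificationSubgroup K S := (QuotientGroup.eq_one_iff _).mp hx
      rw [QuotientGroup.eq_one_iff, ← comap_absGaloisRestrict_ramificationSubgroup L S hKS]
      exact hx'
  -- range
  have hmem : ∀ x, f₀ x ∈ ((absGaloisRestrict K L).range).map (toUnramifiedQuot K S) := by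
    intro x
    induction x using QuotientGroup.induction_on with
    | H σ => exact ⟨absGaloisRestrict K L σ, ⟨σ, rfl⟩, rfl⟩
  let f : GaloisGroupUnramifiedOutside L {w : HeightOneSpectrum (𝓞 L) | w.under (𝓞 K) ∈ S} →*
      ↥(((absGaloisRestrict K L).range).map (toUnramifiedQuot K S) :
        Subgroup (GaloisGroupUnramifiedOutside K S)) := f₀.codRestrict _ hmem
  have hbij : Function.Bijective f := by
    refine ⟨fun x y h => hinj₀ (congrArg Subtype.val h), ?_⟩
    rintro ⟨_, ⟨_, ⟨σ, rfl⟩, rfl⟩⟩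
    exact ⟨(σ : GaloisGroupUnramifiedOutside L {w : HeightOneSpectrum (𝓞 L) | w.under (𝓞 K) ∈ S}), Subtype.ext (hf₀ σ)⟩
  have hcont : Continuous f := hcont₀.subtype_mk _
  let e : GaloisGroupUnramifiedOutside L {w : HeightOneSpectrum (𝓞 L) | w.under (𝓞 K) ∈ S} ≃*
      ↥(((absGaloisRestrict K L).range).map (toUnramifiedQuot K S) :
        Subgroup (GaloisGroupUnramifiedOutside K S)) :=
    MulEquiv.ofBijective f hbij
  have hcont' : Continuous e := hcont
  exact ⟨{ e with
      continuous_toFun := hcont'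
      continuous_invFun := (Continuous.homeoOfEquivCompactToT2 (f := e.toEquiv) hcont').symm.continuous },
    fun σ => hf₀ σ⟩

end Hom

end Literature.NumberTheory.GaloisRepresentations

end
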